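import Literature.MathematicalPhysics.QuantumFieldTheory.Balaban1983to89.B8Prop5UniqKLevel
import Literature.MathematicalPhysics.QuantumFieldTheory.Balaban1983to89.B8LambdaSpaceKLevelOn

/-!
# `Balaban1983to89.B8Prop5UniqKLevelPer` — [Balaban1985RegularSpaces] p. 94 / p. 97 ON THE TORUS (§3 p. 98): the inverse change of variables
# `λ′ ↦ λ_t` (`λ_t + H_cλ_t = λ′`) ON THE PERIODIC CONFIGURATIONS, the `H_c`-sizes read at periodic `λ` only
# (sub-row «G-B8-T2S», RULING #4 v3, layer 3(h)-1 of `lit-balaban-t2s-1/g2/V3-DESIGN.md`)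

statement-level skeleton of published theorems with citation tags; proofs where landed; nothing here is a claim about the
Yang–Mills mass gap

T. Bałaban, *Spaces of regular gauge field configurations on a lattice and gauge fixing conditions*, Commun. Math. Phys. **99** (1985) 75–102
`[Balaban1985RegularSpaces]` ("B8"): p. 94 (after (1.109)), p. 97 (after (1.125)), (1.113) p. 95, (1.102) p. 93, §3 p. 98.  STATUS: published, refereed.

CITATION HEADER (lean-in-tree rule).  Cell `lit-balaban`, seat `lit-balaban-t2s-1` (gen 2).  WHAT IS PROVED (0 sorry, no `def`).
★ `sectE_inverse_kLevel_per` — `B8Prop5UniqKLevel.sectE_inverse_kLevel` VERBATIM except: the sizes/moduli `hc0`, `hc1`, `hcL0`, `hcL1` of the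
Sect. E correction `H_c` are assumed at `P`-PERIODIC `λ` only (RULING #4), `H_c` is periodic-valued there (`hcper`), `λ′` is periodic; the
½-contraction `t ↦ λ′ − H_cλ_t` is run on the closed periodic subset (`B8LambdaSpaceKLevelOn.fixedPoint_closedBall_on`, `perSet`); ADDED conclusion:
`λ_t` is periodic.  First brick of the uniqueness side (1.109) on the torus (`B8Prop5UniqKLevelB.isFixedPoint_of_cond179_bdd` per is next).

HONEST SCOPE.  Verbatim re-thread; Sect. E NOT proved (displayed `H_c`); count-neutral; N05 ∕ `stub_PV3A` NOT discharged; nothing continuum ∕ ℝ⁴ ∕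
OS ∕ mass-gap ∕ Clay — the Yang–Mills mass gap is NOT proved.  No `sorry`, no `def`, no `… : Prop` fact, no `instance`, no `notation`.
-/

noncomputable section

open NormedSpace Metric Set Filter Topology
open Complex (I)

namespace Literature.MathematicalPhysics.QuantumFieldTheory.Balaban1983to89.B8Prop5UniqKLevelPer

open B7Prop1Explicit (e U1)
open B8Ineq132 (covDerivFwd covDeriv)
open B8LambdaSpaceKLevel (wt wt_pos wt_nonneg lamSubK lamOf lamOf_sub norm_lamOf_le weight_mul_norm_covDerivFwd_le mkLam lamOf_mkLam
  norm_mkLam_le norm_le_iff norm_sub_le_iff covDerivFwd_sub')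
open B8LambdaSpaceKLevelOn (fixedPoint_closedBall_on perSet mem_perSet isClosed_perSet zero_mem_perSet)

-- `Site` alone could resolve to the torus sites of `Setup.lean`; re-export the `ℤ^d` sites of `B7Prop1Explicit`.
export B7Prop1Explicit (Site)

variable {d : ℕ} {𝔸 : Type*} [CStarAlgebra 𝔸] [Nontrivial 𝔸]

section Inverse

variable {L k : ℕ} {η : ℝ} {Eb : ℕ → Set (Site d × Fin d)} {U₀ : Site d → Fin d → 𝔸ˣ}

omit [Nontrivial 𝔸] in
/-- ★ **THE INVERSE CHANGE OF VARIABLES `λ′ ↦ λ_t` ON THE PERIODIC CONFIGURATIONS** — `B8Prop5UniqKLevel.sectE_inverse_kLevel` VERBATIM with the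
`H_c`-sizes at periodic `λ` only, `H_c` periodic-valued, `λ′` periodic; `λ_t` periodic. [cite: Balaban1985RegularSpaces, p.94 (after (1.109)), p.97 (after (1.125)), (1.113) p.95, (1.102) p.93, §3 p.98] -/
theorem sectE_inverse_kLevel_per (hη : 0 < η) (P : ℤ) (Hc : (Site d → 𝔸) → (Site d → 𝔸)) {α₄ h₀ h₁ l₀ l₁ ρ : ℝ}
    (hh₀ : 0 ≤ h₀) (hl₀' : l₀ ≤ 1 / 2) (hl₁' : l₁ ≤ 1 / 2) (hρ₀ : ρ + h₀ ≤ α₄ / 4) (hρ₁ : ρ + h₁ ≤ α₄ / 4)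
    (hc0 : ∀ s : lamSubK η U₀ L k Eb, (∀ (z : Site d) (i : Fin d), lamOf s (z + P • e i) = lamOf s z) → ‖s‖ ≤ α₄ / 4 →
      ∀ x, ‖Hc (lamOf s) x‖ ≤ h₀)
    (hc1 : ∀ s : lamSubK η U₀ L k Eb, (∀ (z : Site d) (i : Fin d), lamOf s (z + P • e i) = lamOf s z) → ‖s‖ ≤ α₄ / 4 →
      ∀ j, j ≤ k → ∀ p ∈ Eb j, wt L η j * ‖covDerivFwd η U₀ p.2 (Hc (lamOf s)) p.1‖ ≤ h₁)
    (hcL0 : ∀ s t : lamSubK η U₀ L k Eb, (∀ (z : Site d) (i : Fin d), lamOf s (z + P • e i) = lamOf s z) → (∀ (z : Site d) (i : Fin d), lamOf t (z + P • e i) = lamOf t z) →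
      ‖s‖ ≤ α₄ / 4 → ‖t‖ ≤ α₄ / 4 → ∀ x, ‖Hc (lamOf s) x - Hc (lamOf t) x‖ ≤ l₀ * ‖s - t‖)
    (hcL1 : ∀ s t : lamSubK η U₀ L k Eb, (∀ (z : Site d) (i : Fin d), lamOf s (z + P • e i) = lamOf s z) → (∀ (z : Site d) (i : Fin d), lamOf t (z + P • e i) = lamOf t z) →
      ‖s‖ ≤ α₄ / 4 → ‖t‖ ≤ α₄ / 4 → ∀ j, j ≤ k → ∀ p ∈ Eb j,
      wt L η j * ‖covDerivFwd η U₀ p.2 (Hc (lamOf s) - Hc (lamOf t)) p.1‖ ≤ l₁ * ‖s - t‖)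
    (hcper : ∀ s : lamSubK η U₀ L k Eb, (∀ (z : Site d) (i : Fin d), lamOf s (z + P • e i) = lamOf s z) → ‖s‖ ≤ α₄ / 4 →
      ∀ (z : Site d) (i : Fin d), Hc (lamOf s) (z + P • e i) = Hc (lamOf s) z)
    {lam : Site d → 𝔸} (hlper : (∀ (z : Site d) (i : Fin d), lam (z + P • e i) = lam z)) (hlρ : ∀ x, ‖lam x‖ ≤ ρ)
    (hDρ : ∀ j, j ≤ k → ∀ p ∈ Eb j, wt L η j * ‖covDerivFwd η U₀ p.2 lam p.1‖ ≤ ρ) :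
    ∃ t : lamSubK η U₀ L k Eb, (∀ (z : Site d) (i : Fin d), lamOf t (z + P • e i) = lamOf t z) ∧ ‖t‖ ≤ α₄ / 4 ∧ lamOf t + Hc (lamOf t) = lam := by
  classical
  -- the two printed members of `λ′ − H_cλ_t` on the ball
  have ha : ∀ t : lamSubK η U₀ L k Eb, (∀ (z : Site d) (i : Fin d), lamOf t (z + P • e i) = lamOf t z) → ‖t‖ ≤ α₄ / 4 → ∀ x, ‖(lam - Hc (lamOf t)) x‖ ≤ ρ + h₀ := fun t hp ht x => by
    rw [Pi.sub_apply]
    exact (norm_sub_le _ _).trans (add_le_add (hlρ x) (hc0 t hp ht x))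
  have hb : ∀ t : lamSubK η U₀ L k Eb, (∀ (z : Site d) (i : Fin d), lamOf t (z + P • e i) = lamOf t z) → ‖t‖ ≤ α₄ / 4 → ∀ j, j ≤ k → ∀ p ∈ Eb j,
      wt L η j * ‖covDerivFwd η U₀ p.2 (lam - Hc (lamOf t)) p.1‖ ≤ ρ + h₁ := fun t hpt ht j hj p hp => by
    have hw : 0 ≤ wt L η j := wt_nonneg L hη.le j
    rw [covDerivFwd_sub']
    calc wt L η j * ‖covDerivFwd η U₀ p.2 lam p.1 - covDerivFwd η U₀ p.2 (Hc (lamOf t)) p.1‖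
        ≤ wt L η j * (‖covDerivFwd η U₀ p.2 lam p.1‖ + ‖covDerivFwd η U₀ p.2 (Hc (lamOf t)) p.1‖) :=
          mul_le_mul_of_nonneg_left (norm_sub_le _ _) hw
      _ ≤ ρ + h₁ := by rw [mul_add]; exact add_le_add (hDρ j hj p hp) (hc1 t hpt ht j hj p hp)
  -- the map `t ↦ λ′ − H_cλ_t` on the ball (and `0` off it, never used)
  -- the closed subset of periodic λ's (invariant: `λ′ − H_cλ_t` is periodic for periodic `λ′`, `λ_t`)
  set S : Set (lamSubK η U₀ L k Eb) := perSet η U₀ L k Eb P with hS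
  set T : lamSubK η U₀ L k Eb → lamSubK η U₀ L k Eb := fun t =>
    if ht : (∀ (z : Site d) (i : Fin d), lamOf t (z + P • e i) = lamOf t z) ∧ ‖t‖ ≤ α₄ / 4 then mkLam hη.le (lam - Hc (lamOf t)) (ha t ht.1 ht.2) (hb t ht.1 ht.2) else 0 with hT
  have hTlam : ∀ t : lamSubK η U₀ L k Eb, (∀ (z : Site d) (i : Fin d), lamOf t (z + P • e i) = lamOf t z) → ‖t‖ ≤ α₄ / 4 → lamOf (T t) = lam - Hc (lamOf t) :=
    fun t hp ht => by simp only [hT, dif_pos (And.intro hp ht), lamOf_mkLam]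
  have hmaps : ∀ t ∈ S, ‖t‖ ≤ α₄ / 4 → ‖T t‖ ≤ α₄ / 4 := fun t hp ht => by
    rw [hS, mem_perSet] at hp
    simp only [hT, dif_pos (And.intro hp ht)]
    exact (norm_mkLam_le hη.le _ (ha t hp ht) (hb t hp ht)).trans (max_le hρ₀ hρ₁)
  have hinv : ∀ t ∈ S, ‖t‖ ≤ α₄ / 4 → T t ∈ S := fun t hp ht => by
    rw [hS, mem_perSet] at hp ⊢
    intro z i
    rw [hTlam t hp ht, Pi.sub_apply, Pi.sub_apply, hlper z i, hcper t hp ht z i]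
  have hlip : ∀ s ∈ S, ∀ t ∈ S, ‖s‖ ≤ α₄ / 4 → ‖t‖ ≤ α₄ / 4 → ‖T s - T t‖ ≤ 1 / 2 * ‖s - t‖ := by
    intro s hps t hpt hs ht
    rw [hS, mem_perSet] at hps hpt
    have hδ : 0 ≤ ‖s - t‖ := norm_nonneg _
    refine (norm_sub_le_iff hη.le (T s) (T t) (by positivity)).2 ⟨fun x => ?_, fun j hj p hp => ?_⟩
    · rw [hTlam s hps hs, hTlam t hpt ht, Pi.sub_apply, Pi.sub_apply, sub_sub_sub_cancel_left, norm_sub_rev]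
      exact (hcL0 s t hps hpt hs ht x).trans (mul_le_mul_of_nonneg_right hl₀' hδ)
    · rw [hTlam s hps hs, hTlam t hpt ht, sub_sub_sub_cancel_left, ← neg_sub, B8LambdaSpaceKLevel.covDerivFwd_neg', norm_neg]
      exact (hcL1 s t hps hpt hs ht j hj p hp).trans (mul_le_mul_of_nonneg_right hl₁' hδ)
  have hρ : 0 ≤ α₄ / 4 := by
    have h1 : 0 ≤ ρ := (norm_nonneg _).trans (hlρ 0)
    linarith
  obtain ⟨t, htS, ht, hfix, -⟩ := fixedPoint_closedBall_on T hρ (by norm_num : (0 : ℝ) ≤ 1 / 2) (by norm_num) S (isClosed_perSet P)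
    (zero_mem_perSet P) hinv hmaps hlip
  rw [hS, mem_perSet] at htS
  refine ⟨t, htS, ht, ?_⟩
  have h := congrArg lamOf hfix
  rw [hTlam t htS ht] at h
  nth_rw 1 [← h]
  exact sub_add_cancel _ _


end Inverse

#print axioms sectE_inverse_kLevel_per

end Literature.MathematicalPhysics.QuantumFieldTheory.Balaban1983to89.B8Prop5UniqKLevelPer

end
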